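import Summits.CriticalPhenomena.PercolationContinuityZ3.Theorems.PercNearOneGluingNoHeavyLowerTailAntitheticCycleTII
import Summits.CriticalPhenomena.PercolationContinuityZ3.Theorems.PercNearOneGluingNoHeavyLowerTailAntitheticHandlePrinciple
import Summits.CriticalPhenomena.PercolationContinuityZ3.Theorems.PercNearOneGluingNoHeavyLowerTailAntitheticHandle
import HarnessLib

/-!
# `NoHeavyLowerTail` (stmt-CriticalPhenomena-4575) — antithetic cluster pairs: THEOREM Θ for a handle FROM THE SOURCE (the case `P = s` left
# open in …AntitheticHandle; HOME/MEMO-gen62.md §2 (P4), prim-hp-2 gen 62)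

Support file (`--supports stmt-CriticalPhenomena-4575`, hull-port prover `prim-hp-2`, gen 62).  No definitions, no named facts, no sorries;
standard axioms.  VERTEX version; notation of …AntitheticBoxes / …AntitheticCycleTII.

* `Antithetic.Box.oplus_source`: EVERY edge set is ⊕-positive at its source: `Σ_{T : s ∈ X T} K₁K₂(X T, Y T) ≥ 0` for all super-odd
  twisted-monotone `K₁, K₂` (the whole colouring cube is one red-dominated box: `Y(Tᶜ) = X(T)`).
* `Antithetic.Cyc.notY_cycle_nonneg`: on the cycle, the event `{s ∈ X, Q ∉ Y}` = `{Q ∉ Y}` (`Q = v q`, `0 < q < n`) is a disjoint union of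
  red-dominated boxes — cells `(i₀, j₀)` = largest red index `< q`, smallest red index `≥ q`, the pairs strictly between blue (no refinement
  is needed since there is no `P`-condition): `Σ_{T : s ∈ X, Q ∉ Y} K₁K₂ ≥ 0` for all `K ∈ 𝒮`.
* **`Antithetic.Cyc.source_handle_vertex_sum_nonneg` (THEOREM Θ, handle from the source)**: cycle `v 0 = s, …`, `Q = v q` (`0 < q < n`), arms
  `u 0 = s, …, u a = y` and `w 0 = Q, …, w b = z` of fresh vertices, `x` fresh joined to `y, z`, `yz ∉ H` ⇒ the vertex antithetic inequality at
  `R = {x}` (HANDLE PRINCIPLE `Pendant.handle_vertex_sum_nonneg_of` with `P = s`).  This graph is NOT a cut composite at `s` (THEOREM 2T does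
  not apply); together with …AntitheticHandle every handle on a cycle through `s` is now covered (the mirror case `Q = s` by exchanging the arms).
[cite: VandenbergHaggstromKahn2005, §1 p. 6 ("Harris' inequality"), §1 p. 3 (open cluster `C_s`)]
-/

noncomputable section

namespace Summit.CriticalPhenomena.PercolationContinuityZ3.Theorems

open Literature.Probability.Percolation
open scoped Classical

namespace Antithetic

namespace Box

variable {V : Type*} [Fintype V]

/-- **Every edge set is ⊕-positive at its source.** [this work] -/
theorem oplus_source (E : Set (Sym2 V)) (s : V) (K₁ K₂ : Set V → Set V → ℝ)
    (hK₁ : ∀ ⦃P P' Q Q' : Set V⦄, P ⊆ P' → Q' ⊆ Q → K₁ P Q ≤ K₁ P' Q') (hso₁ : ∀ P Q, 0 ≤ K₁ P Q + K₁ Q P)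
    (hK₂ : ∀ ⦃P P' Q Q' : Set V⦄, P ⊆ P' → Q' ⊆ Q → K₂ P Q ≤ K₂ P' Q') (hso₂ : ∀ P Q, 0 ≤ K₂ P Q + K₂ Q P) :
    0 ≤ ∑ T ∈ Finset.univ.filter (fun T : Set (Sym2 V) => s ∈ openCluster (T ∩ E) s),
      K₁ (openCluster (T ∩ E) s) (openCluster (Tᶜ ∩ E) s) * K₂ (openCluster (T ∩ E) s) (openCluster (Tᶜ ∩ E) s) := by
  have h := box_sum_nonneg E s ∅ ∅ (fun T T' _ _ hflip => ?_) hK₁ hso₁ hK₂ hso₂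
  · convert h using 2
    ext T
    simp only [Finset.mem_filter, Finset.mem_univ, true_and, Set.mem_empty_iff_false, false_implies, implies_true, iff_true]
    exact mem_openCluster_self _ _
  · have hTT : T'ᶜ = T := by
      ext e
      rw [Set.mem_compl_iff]
      constructor
      · intro he
        by_contra h
        exact he ((hflip e (Set.notMem_empty e)).2 h)
      · intro he he'
        exact (hflip e (Set.notMem_empty e)).1 he' he
    rw [hTT]

end Box

namespace Cyc

variable {V : Type*} {n : ℕ} {v : ℕ → V} (hn : 3 ≤ n) (hinj : ∀ i j, i < n → j < n → v i = v j → i = j) (hper : v n = v 0)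
include hn hinj hper

/-- **Red domination of the `(i₀, j₀)` cells**: if `edge i₀`, `edge j₀` (`i₀ < j₀ < n`) are red in `ω'`, and `ω, ω'` are opposite on every pair
`edge i` with `i < i₀` or `j₀ < i < n` that is not forced red in `ω'`... precisely: for `i < i₀` or `j₀ < i < n`, `edge v i ∈ ω'` implies nothing and
`edge v i ∉ ω'` implies `edge v i ∈ ω` — then `Y ω' ⊆ X ω`. [this work] -/
theorem dom_interval (ω ω' : Set (Sym2 V)) {i₀ j₀ : ℕ} (hij : i₀ < j₀) (hj₀ : j₀ < n) (hi₀red : edge v i₀ ∈ ω') (hj₀red : edge v j₀ ∈ ω')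
    (hout : ∀ i, i < n → (i < i₀ ∨ j₀ < i) → edge v i ∉ ω' → edge v i ∈ ω) :
    openCluster (ω'ᶜ ∩ edgeSet n v) (v 0) ⊆ openCluster (ω ∩ edgeSet n v) (v 0) := by
  intro u hu
  obtain ⟨c, hcn, rfl⟩ := idx_of_mem_X hn hinj hper ω'ᶜ hu
  by_cases hc0 : c = 0
  · rw [hc0]; exact mem_openCluster_self _ _
  have hc0' : 0 < c := Nat.pos_of_ne_zero hc0
  rcases (mem_X_iff hn hinj hper ω'ᶜ hc0' hcn).1 hu with hcw | hccw
  · -- the blue route of `ω'` to `v c` is clockwise: it stops before `edge i₀`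
    by_cases hci : i₀ < c
    · exact absurd hi₀red (hcw i₀ hci)
    · exact (mem_X_iff hn hinj hper ω hc0' hcn).2 (Or.inl fun i hi => hout i (by omega) (Or.inl (by omega)) (hcw i hi))
  · by_cases hcj : c ≤ j₀
    · exact absurd hj₀red (hccw j₀ hcj hj₀)
    · exact (mem_X_iff hn hinj hper ω hc0' hcn).2 (Or.inr fun i hci hin => hout i hin (Or.inr (by omega)) (hccw i hci hin))

/-- **The event `{Q ∉ Y}` on a cycle is box-decomposable**: for `Q = v q` (`0 < q < n`) and all super-odd twisted-monotone `K₁, K₂`,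
`0 ≤ Σ_{T : s ∈ X T, Q ∉ Y T} K₁(X T, Y T)·K₂(X T, Y T)` (the conjunct `s ∈ X` is vacuous; it matches the mixed form with `P = s`). [this work] -/
theorem notY_cycle_nonneg [Fintype V] {q : ℕ} (hq0 : 0 < q) (hqn : q < n) (K₁ K₂ : Set V → Set V → ℝ)
    (hK₁ : ∀ ⦃P P' Q Q' : Set V⦄, P ⊆ P' → Q' ⊆ Q → K₁ P Q ≤ K₁ P' Q') (hso₁ : ∀ P Q, 0 ≤ K₁ P Q + K₁ Q P)
    (hK₂ : ∀ ⦃P P' Q Q' : Set V⦄, P ⊆ P' → Q' ⊆ Q → K₂ P Q ≤ K₂ P' Q') (hso₂ : ∀ P Q, 0 ≤ K₂ P Q + K₂ Q P) :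
    0 ≤ ∑ ω ∈ Finset.univ.filter (fun ω : Set (Sym2 V) =>
        v 0 ∈ openCluster (ω ∩ edgeSet n v) (v 0) ∧ v q ∉ openCluster (ωᶜ ∩ edgeSet n v) (v 0)),
      K₁ (openCluster (ω ∩ edgeSet n v) (v 0)) (openCluster (ωᶜ ∩ edgeSet n v) (v 0)) *
        K₂ (openCluster (ω ∩ edgeSet n v) (v 0)) (openCluster (ωᶜ ∩ edgeSet n v) (v 0)) := by
  -- cells `(i₀, j₀)`: `edge i₀`, `edge j₀` red, the pairs strictly between blue, the rest free
  let C := {t : ℕ × ℕ // t.1 < q ∧ q ≤ t.2 ∧ t.2 < n}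
  let FixF : ℕ → ℕ → Set (Sym2 V) := fun i₀ j₀ => {e | ∃ i, i < n ∧ i₀ ≤ i ∧ i ≤ j₀ ∧ e = edge v i}
  let NF : ℕ → ℕ → Set (Sym2 V) := fun i₀ j₀ => {e | ∃ i, i < n ∧ (i = i₀ ∨ i = j₀) ∧ e = edge v i}
  let Fix : C → Set (Sym2 V) := fun c => FixF c.1.1 c.1.2
  let N : C → Set (Sym2 V) := fun c => NF c.1.1 c.1.2
  have hedge_inj : ∀ {i i' : ℕ}, i < n → i' < n → edge v i = edge v i' → i = i' := fun hi hi' h => edge_inj hn hinj hper hi hi' h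
  have hmem_iff : ∀ (i₀ j₀ : ℕ) (hv : i₀ < q ∧ q ≤ j₀ ∧ j₀ < n) (ω : Set (Sym2 V)),
      (∀ e ∈ FixF i₀ j₀, (e ∈ ω ↔ e ∈ NF i₀ j₀)) ↔
        (edge v i₀ ∈ ω ∧ edge v j₀ ∈ ω ∧ ∀ i, i₀ < i → i < j₀ → edge v i ∉ ω) := by
    intro i₀ j₀ hv ω
    have hmemN : ∀ i, i < n → (edge v i ∈ NF i₀ j₀ ↔ (i = i₀ ∨ i = j₀)) := by
      intro i hi
      constructor
      · rintro ⟨i', hi', hor, he⟩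
        rw [hedge_inj hi hi' he]; exact hor
      · exact fun h => ⟨i, hi, h, rfl⟩
    constructor
    · intro h
      refine ⟨?_, ?_, fun i h1 h2 hiω => ?_⟩
      · exact (h (edge v i₀) ⟨i₀, by omega, le_rfl, by omega, rfl⟩).2 ((hmemN i₀ (by omega)).2 (Or.inl rfl))
      · exact (h (edge v j₀) ⟨j₀, hv.2.2, by omega, le_rfl, rfl⟩).2 ((hmemN j₀ hv.2.2).2 (Or.inr rfl))
      · have := (h (edge v i) ⟨i, by omega, by omega, by omega, rfl⟩).1 hiω
        rw [hmemN i (by omega)] at this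
        omega
    · rintro ⟨h0, h1, hbl⟩ e ⟨i, hi, hlo, hhi, rfl⟩
      rw [hmemN i hi]
      by_cases hi0 : i = i₀
      · subst hi0; exact iff_of_true h0 (Or.inl rfl)
      by_cases hi1 : i = j₀
      · subst hi1; exact iff_of_true h1 (Or.inr rfl)
      exact iff_of_false (hbl i (by omega) (by omega)) (by omega)
  refine Box.boxes_sum_nonneg (edgeSet n v) (v 0) _ Fix N ?_ ?_ ?_ ?_ hK₁ hso₁ hK₂ hso₂
  · -- cover: `i₀` = largest red index `< q`, `j₀` = smallest red index `≥ q`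
    intro ω hω
    obtain ⟨-, hQ⟩ := (Finset.mem_filter.1 hω).2
    obtain ⟨⟨i₁, hi₁q, hi₁⟩, ⟨j₁, hqj₁, hj₁n, hj₁⟩⟩ := (not_mem_Y_iff hn hinj hper ω hq0 hqn).1 hQ
    have hexI : ∃ m, m < q ∧ edge v (q - 1 - m) ∈ ω :=
      ⟨q - 1 - i₁, by omega, by rwa [show q - 1 - (q - 1 - i₁) = i₁ by omega]⟩
    have hspI := Nat.find_spec hexI
    have hi₀max : ∀ m, q - 1 - Nat.find hexI < m → m < q → edge v m ∉ ω := by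
      intro m h1 h2 hm
      have hmin := Nat.find_min hexI (m := q - 1 - m) (by omega)
      exact hmin ⟨by omega, by rwa [show q - 1 - (q - 1 - m) = m by omega]⟩
    obtain ⟨i₀, hi₀def⟩ : ∃ i₀, i₀ = q - 1 - Nat.find hexI := ⟨_, rfl⟩
    have hi₀red : edge v i₀ ∈ ω := by rw [hi₀def]; exact hspI.2
    rw [← hi₀def] at hi₀max
    have hi₀q : i₀ < q := by omega
    have hexJ : ∃ j, q ≤ j ∧ j < n ∧ edge v j ∈ ω := ⟨j₁, hqj₁, hj₁n, hj₁⟩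
    have hspJ := Nat.find_spec hexJ
    have hj₀min : ∀ m, q ≤ m → m < Nat.find hexJ → edge v m ∉ ω := by
      intro m h1 h2 hm
      exact Nat.find_min hexJ h2 ⟨h1, by omega, hm⟩
    obtain ⟨j₀, hj₀def⟩ : ∃ j₀, j₀ = Nat.find hexJ := ⟨_, rfl⟩
    rw [← hj₀def] at hspJ hj₀min
    obtain ⟨hqj₀, hj₀n, hj₀red⟩ := hspJ
    refine ⟨⟨(i₀, j₀), hi₀q, hqj₀, hj₀n⟩, (hmem_iff i₀ j₀ ⟨hi₀q, hqj₀, hj₀n⟩ ω).2 ⟨hi₀red, hj₀red, fun i h1 h2 => ?_⟩⟩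
    by_cases hiq : i < q
    · exact hi₀max i h1 hiq
    · exact hj₀min i (by omega) h2
  · -- inside
    rintro ⟨⟨i₀, j₀⟩, hv⟩ ω hmem
    obtain ⟨h0, h1, -⟩ := (hmem_iff i₀ j₀ hv ω).1 hmem
    have hv' : i₀ < q ∧ q ≤ j₀ ∧ j₀ < n := hv
    refine Finset.mem_filter.2 ⟨Finset.mem_univ _, mem_openCluster_self _ _, ?_⟩
    exact (not_mem_Y_iff hn hinj hper ω hq0 hqn).2 ⟨⟨i₀, hv'.1, h0⟩, ⟨j₀, hv'.2.1, hv'.2.2, h1⟩⟩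
  · -- uniqueness
    rintro ⟨⟨i₀, j₀⟩, hv⟩ ⟨⟨i₀', j₀'⟩, hv'⟩ ω hmem hmem'
    obtain ⟨h0, h1, hbl⟩ := (hmem_iff i₀ j₀ hv ω).1 hmem
    obtain ⟨h0', h1', hbl'⟩ := (hmem_iff i₀' j₀' hv' ω).1 hmem'
    have hv1 : i₀ < q ∧ q ≤ j₀ ∧ j₀ < n := hv
    have hv2 : i₀' < q ∧ q ≤ j₀' ∧ j₀' < n := hv'
    have hI : i₀ = i₀' := by
      by_contra hne
      rcases Nat.lt_or_gt_of_ne hne with h | h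
      · exact hbl i₀' h (by omega) h0'
      · exact hbl' i₀ h (by omega) h0
    have hJ : j₀ = j₀' := by
      by_contra hne
      rcases Nat.lt_or_gt_of_ne hne with h | h
      · exact hbl' j₀ (by omega) h h1
      · exact hbl j₀' (by omega) h h1'
    subst hI hJ
    rfl
  · -- red domination
    rintro ⟨⟨i₀, j₀⟩, hv⟩ ω ω' hmem hmem' hflip
    obtain ⟨h0', h1', -⟩ := (hmem_iff i₀ j₀ hv ω').1 hmem'
    have hv1 : i₀ < q ∧ q ≤ j₀ ∧ j₀ < n := hv
    refine dom_interval hn hinj hper ω ω' (show i₀ < j₀ by omega) hv1.2.2 h0' h1' fun i hi hout hiω' => ?_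
    have hfree : edge v i ∉ FixF i₀ j₀ := by
      rintro ⟨i', hi', hlo, hhi, he⟩
      have := hedge_inj hi hi' he
      subst this
      omega
    by_contra h
    exact hiω' ((hflip (edge v i) hfree).2 h)

variable [Fintype V] {q : ℕ} (hq0 : 0 < q) (hqn : q < n)
  {u w : ℕ → V} {a b : ℕ} (hu0 : u 0 = v 0) (hw0 : w 0 = v q)
  (hufresh : ∀ i, 0 < i → i ≤ a → ∀ f ∈ edgeSet n v ∪ edgeSet b w, u i ∈ f → f.IsDiag)
  (hwfresh : ∀ i, 0 < i → i ≤ b → ∀ f ∈ edgeSet n v, w i ∈ f → f.IsDiag)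
  (huinj : ∀ i j, i ≤ a → j ≤ a → u i = u j → i = j) (hwinj : ∀ i j, i ≤ b → j ≤ b → w i = w j → i = j)
include hq0 hqn hu0 hw0 hufresh hwfresh huinj hwinj

/-- **THEOREM Θ, handle from the source** (HOME/MEMO-gen62.md §2 (P4)): cycle `v 0 = s, …, v (n−1)`, `Q = v q` (`0 < q < n`), arms
`u 0 = s, …, u a = y` and `w 0 = Q, …, w b = z` of fresh vertices, `x` fresh joined to `y, z`, `yz` not a pair of `H = (z-arm ∪ cycle) ∪ y-arm`
(written in this order to distinguish the statement from `Cyc.handle_vertex_sum_nonneg`, whose hypotheses `0 < p` exclude this case);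
`E = H + xy + xz`.
Then for all monotone `F, G`: `0 ≤ Σ_{ω : ¬(x ∈ X_E ω ∧ x ∈ Y_E ω)} (F(X_E ω) − F(Y_E ω))·(G(X_E ω) − G(Y_E ω))`. [this work] -/
theorem source_handle_vertex_sum_nonneg {x : V} (hx : ∀ f ∈ (edgeSet b w ∪ edgeSet n v) ∪ edgeSet a u, x ∈ f → f.IsDiag)
    (hxs : x ≠ v 0) (hxy : x ≠ u a) (hxz : x ≠ w b) (hyz : u a ≠ w b) (hg : s(u a, w b) ∉ (edgeSet b w ∪ edgeSet n v) ∪ edgeSet a u)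
    {F G : Set V → ℝ} (hF : Monotone F) (hG : Monotone G) :
    0 ≤ ∑ ω ∈ Finset.univ.filter (fun ω : Set (Sym2 V) =>
        ¬ ((openGraph (ω ∩ insert s(x, u a) (insert s(x, w b) ((edgeSet b w ∪ edgeSet n v) ∪ edgeSet a u)))).Reachable (v 0) x ∧
          (openGraph (ωᶜ ∩ insert s(x, u a) (insert s(x, w b) ((edgeSet b w ∪ edgeSet n v) ∪ edgeSet a u)))).Reachable (v 0) x)),
      (F (openCluster (ω ∩ insert s(x, u a) (insert s(x, w b) ((edgeSet b w ∪ edgeSet n v) ∪ edgeSet a u))) (v 0)) -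
          F (openCluster (ωᶜ ∩ insert s(x, u a) (insert s(x, w b) ((edgeSet b w ∪ edgeSet n v) ∪ edgeSet a u))) (v 0))) *
        (G (openCluster (ω ∩ insert s(x, u a) (insert s(x, w b) ((edgeSet b w ∪ edgeSet n v) ∪ edgeSet a u))) (v 0)) -
          G (openCluster (ωᶜ ∩ insert s(x, u a) (insert s(x, w b) ((edgeSet b w ∪ edgeSet n v) ∪ edgeSet a u))) (v 0))) := by
  have hufresh' : ∀ i, 0 < i → i ≤ a → ∀ f ∈ edgeSet n v, u i ∈ f → f.IsDiag :=
    fun i hi hia f hf => hufresh i hi hia f (Or.inl hf)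
  have hsu : ∀ i, 0 < i → i ≤ a → v 0 ≠ u i := fun i hi hia => v_ne_arm hn hinj hper hufresh' (by omega) hi hia
  have hsw : ∀ i, 0 < i → i ≤ b → v 0 ≠ w i := fun i hi hib => v_ne_arm hn hinj hper hwfresh (by omega) hi hib
  have hzu : ∀ i, 0 < i → i ≤ a → w b ≠ u i :=
    fun i hi hia => end_ne_arm hufresh hwinj (fun k hk hka => by rw [hw0]; exact v_ne_arm hn hinj hper hufresh' hqn hk hka) hi hia
  have hnd : ∀ f ∈ edgeSet n v, ¬ f.IsDiag := by
    rintro f ⟨i, hi, rfl⟩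
    rw [edge, Sym2.mk_isDiag_iff]; exact v_ne_succ hn hinj hper hi
  have hcomm : edgeSet b w ∪ edgeSet n v = edgeSet n v ∪ edgeSet b w := Set.union_comm _ _
  rw [hcomm] at hx hg
  have h := Pendant.handle_vertex_sum_nonneg_of (E₀ := edgeSet n v) hu0 hw0 hufresh hwfresh huinj hwinj hsu hsw hsw hzu ?_ ?_ hnd hx hxs
    hxy hxz hyz hg hF hG
  · rw [hcomm]
    exact h
  · intro j hj K₁ K₂ hK₁ hso₁ hK₂ hso₂
    exact Box.oplus_source _ _ K₁ K₂ hK₁ hso₁ hK₂ hso₂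
  · intro K₁ K₂ hK₁ hso₁ hK₂ hso₂
    exact notY_cycle_nonneg hn hinj hper hq0 hqn K₁ K₂ hK₁ hso₁ hK₂ hso₂

end Cyc

end Antithetic

end Summit.CriticalPhenomena.PercolationContinuityZ3.Theorems
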